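import Summits.HodgeConjecture.HodgeConjecture.Theorems.NikulinTwinTransportHodgeSimilitudeAlgebraicTwinTransport
import Literature.AlgebraicGeometry.Surfaces.K3ComplexMultiplication

/-!
# Line `cm-norm-anchors` — skeleton for crux `HodgeSimilitudeAlgebraic` (stmt-HodgeConjecture-13676)

Route `NikulinTwinTransport`, crux `HodgeSimilitudeAlgebraic` (rank 5, ALL multipliers: every
rational Hodge `r`-similitude `H²(S′) → H²(S)` between projective K3 surfaces is algebraic).
Idea card `Cruxes/HodgeSimilitudeAlgebraic/Ideas/cm-norm-anchors.md` (triage r1: pass ×3, "anchor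
module; the open part is the transport engine").

THE LINE. By the landed reductions of the crux
(`hodgeSimilitudeAlgebraic_of_prime_twinTransport`: Buskin + composition of correspondences +
three K3 period facts + — for every PRIME `q` — twin transport for the rational `q`-similitudes
`M` of the K3 lattice ⟹ the crux), everything is pinned to `TwinTransportFor[M]`: the twin
similitude `η⁻¹ ∘ M ∘ η′` is algebraic on every `M`-twin pair of marked projective K3 surfaces.
The card's lever supplies that conclusion on a DENSE, EXPLICIT sub-locus of every twin family —
the pairs whose SOURCE `(S′, η′, x′)` is a CM-NORM K3 of multiplier `q` (its period `x′` is an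
eigen-period, with non-real eigenvalue, of a rational `q`-similitude `J` of `Λ`; equivalently
`E = End_Hdg(T(S′)_ℚ)` is a CM field containing an element of norm `q`): there
`ψ = (ψ ∘ e′⁻¹) ∘ e′` with `e′ = η′⁻¹ J η′` a rational Hodge SELF-`q`-similitude of `S′` — algebraic
on `S′ × S′` by the Hodge conjecture for CM squares (Buskin's Corollary, the tree's named fact
`Buskin2019_hodgeConjectureFor_square_of_CM`) — and `ψ ∘ e′⁻¹` a rational Hodge ISOMETRY,
algebraic by Buskin's theorem (route item `HodgeIsometryAlgebraic`); compose. The one open stub is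
the ENGINE: propagation of twin transport from this dense anchor locus to all twin pairs (the
variational Hodge statement for the flat twin class on the connected twin family), which is the
deliverable of the engine lines (`semiregular-twin-hecke-vhc` via Perry 2026 Thm 1.1,
`reduced-dt4-twin-count` via Bae–Kool–Park Thm 1.15, or the route's informal K2
`TwinTwistorTransport`), now handed explicit anchors everywhere — including the DIAGONAL
self-pairs `(S₀, S₀)` of CM-type `M` (T-rank-20 families `𝒰_q` for every `q`, Gauss-sum /
automorphism-graph carriers on the non-symplectic loci `𝒩_p`, `p ≤ 19`).

STUBS (6), the sorry-free implication `lineImplication : stub₁ → … → stub₆ → crux` (spelled out as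
`LineImplication`) and the composition `HodgeSimilitudeAlgebraic_of` (crux by name, from the stubs):
* `stub_buskin` — Buskin 2019 Thm 1.1 = route item `HodgeIsometryAlgebraic` (13675), by name.
* `stub_compCorr` — composition of algebraic correspondences between smooth projective surfaces
  (Fulton Prop. 16.1.1; verbatim the `hC` of the landed reductions; provable from
  `Literature…K3CorrespondenceComposition.corrComp_of_baseChange` given Gysin base change + moving).
* `stub_k3Facts` — the four VENDORED named facts of `Literature/AlgebraicGeometry/Surfaces` the line
  consumes (CM-square corollary; period surjectivity; markings; Hodge types of `H²(K3)`).
* `stub_cmSelfSimilitude_algebraic` — THE ANCHOR THEOREM: on a marked projective K3 whose period is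
  a non-real eigen-period of a rational similitude `J`, the self-map `η⁻¹ J η` is an algebraic
  correspondence (granted the CM-square fact and the Hodge types: `η⁻¹Jη` is a rational Hodge
  endomorphism witnessing `HasComplexMultiplication`; its Künneth graph class is a rational
  `(2,2)`-class on `S × S`).
* `stub_cmNormPeriods_dense` — CM-norm periods of multiplier `q` are dense among projective period
  points, for every prime `q` (Witt: `⟨1,q⟩ ⊕ ⟨−1,−q⟩⁹ ⊕ U ≅_ℚ Λ_ℚ`; singular K3 periods with
  `disc T ≡ q`; rational points dense on quadrics with a rational point).
* `stub_twinPropagation` — THE ENGINE (open): density + transport on CM-norm-source pairs ⟹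
  `TwinTransportFor[M]`.

Disproof used: `Disproof.lean` (cdisprove gen-2 v1–v4, evidence notes; file not mounted on this
hub): `crux_iff_squarefree` / `primes_suffice` (we work prime by prime through the landed
`hodgeSimilitudeAlgebraic_of_prime_twinTransport`, whose hidden glue `CompAlg` is our explicit
`stub_compCorr`); load-bearing hypotheses `hrat`, `htype` are honoured (every similitude here is
conjugated through markings: `isRationalClass_markingConj`, `isOfHodgeType_markingConj`); v3/v4
("anchor supply is not where the risk is; the risk is the transport, once per prime") is exactly
the shape of this skeleton — five provable/vendored stubs and ONE open engine stub; no stub is an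
instance of a landed Negative lemma (none landed for this crux); negatives index (ELineConnectivity,
DerivedTorelliFermat exhaustion) untouched — no twistor-connectivity statement is made.
-/

set_option linter.dupNamespace false

noncomputable section

open CategoryTheory MonoidalCategory
open scoped Manifold
open Literature.AlgebraicGeometry.Motives Literature.AlgebraicGeometry.HodgeTheory
open Literature.AlgebraicGeometry.Surfaces Literature.Geometry.Kaehler
open Literature.AlgebraicTopology.SingularHomology
open Summit.HodgeConjecture.HodgeConjecture.Theses.NikulinTwinTransport
open Summit.HodgeConjecture.HodgeConjecture.Theorems.NikulinTwinTransport

namespace Summit.HodgeConjecture.HodgeConjecture.Cruxes.HodgeSimilitudeAlgebraic.CmNormAnchors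

/-! ### Local notations (verbatim those of the landed glue files of the crux) -/

/-- `MarkedK3[S, η, p, x]`: a marked K3 surface with period `x`. Local notation only, verbatim
from `NikulinTwinTransportHodgeSimilitudeAlgebraicTwinTransport`. -/
local notation3 (prettyPrint := false) "MarkedK3[" S ", " η ", " p ", " x "]" =>
  (IsIntegralClass p ∧
    (∀ q : complexBetti S (2 * 2), IsIntegralClass q → ∃ n : ℤ, q = n • p) ∧
    (∀ c : complexBetti S (2 * 1), IsIntegralClass c ↔ ∃ v : K3Index → ℤ, η c = fun i => (v i : ℂ)) ∧
    (∀ a b : complexBetti S (2 * 1),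
        cupProduct (rfl : 2 * 1 + 2 * 1 = 2 * 2) a b = k3Form (η a) (η b) • p) ∧
    IsOfHodgeType 2 S (2 * 1) 2 0 (LinearEquiv.symm η x) ∧
    (∀ τ : complexBetti S (2 * 1), IsOfHodgeType 2 S (2 * 1) 2 0 τ → ∃ t : ℂ, τ = t • LinearEquiv.symm η x))

/-- `PeriodPt[x]`: a projective period point. Local notation only, verbatim from the glue files. -/
local notation3 (prettyPrint := false) "PeriodPt[" x "]" =>
  (k3Form x x = 0 ∧ 0 < (k3Form (star x) x).re ∧
    ∃ u : K3Index → ℤ, k3Form (fun i => (u i : ℂ)) x = 0 ∧ 0 < ∑ i, ∑ j, u i * k3Gram i j * u j)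

/-- `Corr[μ, S, S', hS, hS' ; γ, y] = [γ]_* y = fst_* (snd^* y ∪ γ)`. Local notation only,
verbatim from the glue files. -/
local notation3 (prettyPrint := false) "Corr[" μ ", " S ", " S' ", " hS ", " hS' " ; " γ ", " y "]" =>
  complexGysin μ
    (IsSmoothProjective.tensor_holds (IsK3Surface.isSmoothProjective hS)
      (IsK3Surface.isSmoothProjective hS'))
    (IsK3Surface.isSmoothProjective hS) (SemiCartesianMonoidalCategory.fst S S')
    (rfl : 2 * 1 + 2 * 2 + 2 * 2 = 2 * 1 + 2 * (2 + 2))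
    (cupProduct (rfl : 2 * 1 + 2 * 2 = 2 * 1 + 2 * 2)
      (complexBetti.map (SemiCartesianMonoidalCategory.snd S S') (2 * 1) y) γ)

/-- `TwinTransportFor[M]`: the twin transport for the endomorphism `M` of `Λ_ℂ` — on every pair of
marked projective K3 surfaces whose periods correspond under `M`, the twin similitude
`η⁻¹ ∘ M ∘ η'` is induced by an algebraic class. Local notation only, verbatim from the glue files. -/
local notation3 (prettyPrint := false) "TwinTransportFor[" M "]" =>
  ∀ (μ : OrientationFamily), μ.HasPoincareDuality →
    ∀ (S S' : SchemeOver ℂ) (hS : IsK3Surface S) (hS' : IsK3Surface S')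
      (η : complexBetti S (2 * 1) ≃ₗ[ℂ] (K3Index → ℂ)) (p : complexBetti S (2 * 2))
      (x : K3Index → ℂ)
      (η' : complexBetti S' (2 * 1) ≃ₗ[ℂ] (K3Index → ℂ)) (p' : complexBetti S' (2 * 2))
      (x' : K3Index → ℂ),
      MarkedK3[S, η, p, x] → PeriodPt[x] → MarkedK3[S', η', p', x'] → PeriodPt[x'] →
      (∃ t : ℂ, M x' = t • x) →
      ∃ γ ∈ algebraicClasses (MonoidalCategoryStruct.tensorObj S S') 2,
        ∀ y : complexBetti S' (2 * 1), η.symm (M (η' y)) = Corr[μ, S, S', hS, hS' ; γ, y]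

/-- `CompCorr`: composition of algebraic correspondences between smooth projective surfaces
(Fulton, *Intersection Theory*, Prop. 16.1.1). Local notation only, verbatim from
`NikulinTwinTransportHodgeSimilitudeAlgebraicPrimes` (hypothesis `hC` of the landed reductions). -/
local notation3 (prettyPrint := false) "CompCorr" =>
  ∀ (μ : OrientationFamily), μ.HasPoincareDuality →
    ∀ (A B C : SchemeOver ℂ) (hA : IsSmoothProjective 2 A) (hB : IsSmoothProjective 2 B)
      (hC : IsSmoothProjective 2 C),
      ∀ γ ∈ algebraicClasses (MonoidalCategoryStruct.tensorObj A B) 2,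
        ∀ γ₁ ∈ algebraicClasses (MonoidalCategoryStruct.tensorObj B C) 2,
          ∃ γ₂ ∈ algebraicClasses (MonoidalCategoryStruct.tensorObj A C) 2,
            ∀ x : complexBetti C (2 * 1),
              complexGysin μ (IsSmoothProjective.tensor_holds hA hC) hA
                  (SemiCartesianMonoidalCategory.fst A C)
                  (rfl : 2 * 1 + 2 * 2 + 2 * 2 = 2 * 1 + 2 * (2 + 2))
                  (cupProduct (rfl : 2 * 1 + 2 * 2 = 2 * 1 + 2 * 2)
                    (complexBetti.map (SemiCartesianMonoidalCategory.snd A C) (2 * 1) x) γ₂) =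
                complexGysin μ (IsSmoothProjective.tensor_holds hA hB) hA
                  (SemiCartesianMonoidalCategory.fst A B)
                  (rfl : 2 * 1 + 2 * 2 + 2 * 2 = 2 * 1 + 2 * (2 + 2))
                  (cupProduct (rfl : 2 * 1 + 2 * 2 = 2 * 1 + 2 * 2)
                    (complexBetti.map (SemiCartesianMonoidalCategory.snd A B) (2 * 1)
                      (complexGysin μ (IsSmoothProjective.tensor_holds hB hC) hB
                        (SemiCartesianMonoidalCategory.fst B C)
                        (rfl : 2 * 1 + 2 * 2 + 2 * 2 = 2 * 1 + 2 * (2 + 2))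
                        (cupProduct (rfl : 2 * 1 + 2 * 2 = 2 * 1 + 2 * 2)
                          (complexBetti.map (SemiCartesianMonoidalCategory.snd B C) (2 * 1) x)
                          γ₁)))
                    γ)

/-! ### Local notations of this line: CM-norm periods -/

/-- `RatEnd[J]`: the endomorphism `J` of `Λ_ℂ = ℂ²²` is defined over `ℚ` (maps `Λ` into `Λ_ℚ`),
the idiom of the glue files. Local notation only. -/
local notation3 (prettyPrint := false) "RatEnd[" J "]" =>
  ∀ v : K3Index → ℤ, ∃ w : K3Index → ℚ, J (fun i => (v i : ℂ)) = fun i => (w i : ℂ)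

/-- `CMNormPeriod[c, x]`: **`x` is a CM-norm period of multiplier `c`** — an eigen-period, with
NON-REAL eigenvalue `t`, of a rational `c`-similitude `J` of `(Λ_ℂ, k3Form)` with two-sided rational
inverse `K`. For a marked projective K3 surface `(S, η)` with period `x` this says:
`e = η⁻¹ J η` is a rational Hodge self-`c`-similitude of `H²(S, ℚ)` acting on `H^{2,0} = ℂ η⁻¹x` by
`t ∉ ℝ`, i.e. `S` has complex multiplication (`HasComplexMultiplication S`, Zarhin) by a CM field
`E ∋ e|_T` with `c = e ē ∈ N_{E/E₀}(E^×)` — the card's CM-NORM ANCHORS (all of `𝒰_q`, `𝒩_p`, and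
the singular K3 surfaces with `disc T(S) ≡ c` mod squares). Local notation only. -/
local notation3 (prettyPrint := false) "CMNormPeriod[" c ", " x "]" =>
  ∃ (J K : Module.End ℂ (K3Index → ℂ)), RatEnd[J] ∧ RatEnd[K] ∧ J * K = 1 ∧ K * J = 1 ∧
    (∀ a b, k3Form (J a) (J b) = c * k3Form a b) ∧ ∃ t : ℂ, t.im ≠ 0 ∧ J x = t • x

/-- `CMNormDense[c]`: the CM-norm periods of multiplier `c` are DENSE among the projective period
points of `Λ_ℂ` (sup metric of `ℂ²²`). Local notation only. -/
local notation3 (prettyPrint := false) "CMNormDense[" c "]" =>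
  ∀ x : K3Index → ℂ, PeriodPt[x] → ∀ ε : ℝ, 0 < ε →
    ∃ x' : K3Index → ℂ, PeriodPt[x'] ∧ dist x' x < ε ∧ CMNormPeriod[c, x']

/-- `CMSourceTransportFor[M, c]`: twin transport for `M` RESTRICTED to the `M`-twin pairs whose
SOURCE `(S', η', x')` is a CM-norm K3 of multiplier `c` — the conclusion of `TwinTransportFor[M]`
under the extra hypothesis `CMNormPeriod[c, x']`. This is what the anchor theorem of the line
delivers (`cmSourceTransport`, proved below from the stubs). Local notation only. -/
local notation3 (prettyPrint := false) "CMSourceTransportFor[" M ", " c "]" =>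
  ∀ (μ : OrientationFamily), μ.HasPoincareDuality →
    ∀ (S S' : SchemeOver ℂ) (hS : IsK3Surface S) (hS' : IsK3Surface S')
      (η : complexBetti S (2 * 1) ≃ₗ[ℂ] (K3Index → ℂ)) (p : complexBetti S (2 * 2))
      (x : K3Index → ℂ)
      (η' : complexBetti S' (2 * 1) ≃ₗ[ℂ] (K3Index → ℂ)) (p' : complexBetti S' (2 * 2))
      (x' : K3Index → ℂ),
      MarkedK3[S, η, p, x] → PeriodPt[x] → MarkedK3[S', η', p', x'] → PeriodPt[x'] →
      (∃ t : ℂ, M x' = t • x) → CMNormPeriod[c, x'] →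
      ∃ γ ∈ algebraicClasses (MonoidalCategoryStruct.tensorObj S S') 2,
        ∀ y : complexBetti S' (2 * 1), η.symm (M (η' y)) = Corr[μ, S, S', hS, hS' ; γ, y]

/-! ### The registered stubs -/

/-- **Stub 1 — Buskin's theorem** (route item `HodgeIsometryAlgebraic`, stmt-HodgeConjecture-13675,
BY NAME; Buskin, J. reine angew. Math. 755 (2019) Thm. 1.1; reproof Huybrechts, Comment. Math.
Helv. 94 (2019) Thm. 0.2): every rational, type-preserving, isometric `φ : H²(S′(ℂ);ℂ) → H²(S(ℂ);ℂ)`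
between projective K3 surfaces is `[γ]_*` for an algebraic `γ` on `S × S′`. Used twice: by the
landed backbone (`Ψ⁻¹ ∘ ψ` is an isometry into the anchor partner) and by `cmSourceTransport`
(`ψ ∘ e′⁻¹` is an isometry). DELEGATED: closes the day item 13675 closes. Size XL (formalising
Buskin), research risk nil. -/
theorem stub_buskin : HodgeIsometryAlgebraic := by
  sorry

/-- **Stub 2 — composition of algebraic correspondences between smooth projective surfaces**
(Fulton, *Intersection Theory* Prop. 16.1.1 / Def. 16.1.2; Buskin 2019 Lemma 6.3): for algebraic
`γ ∈ N²H⁴(A × B)`, `γ₁ ∈ N²H⁴(B × C)` there is an algebraic `γ₂ ∈ N²H⁴(A × C)` with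
`[γ₂]_* = [γ]_* ∘ [γ₁]_*` on `H²(C(ℂ);ℂ)`. Verbatim the hypothesis `hC` of the landed reductions
`hodgeSimilitudeAlgebraic_of_prime_anchors` / `_of_prime_twinTransport`. Formal debt of the tree:
provable from `Literature.AlgebraicGeometry.Surfaces.corrComp_of_baseChange` once Gysin base change
for the product square (`hBC`, needs the Künneth cross product) and the moving-lemma input
(`hCUP`, `cupProduct_mem_algebraicClasses_of_moving`) are in; size L, research risk nil. -/
theorem stub_compCorr : CompCorr := by
  sorry

/-- **Stub 3 — the vendored K3 package** (four NAMED FACTS of `Literature/AlgebraicGeometry/Surfaces`,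
each closing when discharged in Literature; research risk nil, formalisation XL):
(i) `Buskin2019_hodgeConjectureFor_square_of_CM` — Buskin 2019 Corollary / Huybrechts 2019 Cor. 0.4
(ii): HC for `S × S` when `End_Hdg(T(S)_ℚ)` is a CM field (ANY `dim_E T`, so the 9-dimensional
families `𝒰_q` are covered as typed — triage r1-2/r1-3); (ii) `Huybrechts_K3_periodSurjective_projective`
(K3 book Ch. 6 Thm 3.1 / Ch. 7 Thm 4.1 + projectivity criterion); (iii) `Huybrechts_K3_marking_exists`
(Ch. 1 Prop. 3.5); (iv) `Huybrechts_K3_hodgeTypes_H2` (Ch. 6 Prop. 1.2). -/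
theorem stub_k3Facts :
    Buskin2019_hodgeConjectureFor_square_of_CM ∧ Huybrechts_K3_periodSurjective_projective ∧
      Huybrechts_K3_marking_exists ∧ Huybrechts_K3_hodgeTypes_H2 := by
  sorry

/-- **Stub 4 — THE ANCHOR THEOREM: rational Hodge self-similitudes of CM K3 surfaces are algebraic
correspondences.** Granted the CM-square corollary and the Hodge types of `H²(K3)`: if `J` is a
rational `c`-similitude (`c ≠ 0`) of `(Λ_ℂ, k3Form)` and `x₀` an eigen-period of `J` with non-real
eigenvalue `t`, then on every marked projective K3 surface `(S, η, p)` with period `x₀` the self-map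
`e = η⁻¹ ∘ J ∘ η` of `H²(S(ℂ);ℂ)` is `[γ]_*` for an algebraic `γ ∈ N²H⁴(S × S)`. Proof route:
`e` is rational (`isRationalClass_markingConj`) and preserves every Hodge type
(`isOfHodgeType_markingConj` with `S = S′`, period condition `J x₀ = t x₀`); `e σ = t σ` for the
non-zero `(2,0)`-class `σ = η⁻¹x₀` with `t ∉ ℝ`, which IS `HasComplexMultiplication S`; hence
`HodgeConjectureFor 4 (S ⊗ S)` by the fact; the Künneth/Poincaré-duality graph class `Z_e` of `e`
(`[Z_e]_* = e` for the orientation family `μ`, rescaled inside the `ℂ`-subspace of algebraic classes)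
is rational and of type `(2,2)` because `e` is rational and type-preserving, so `Z_e` is algebraic
(`mem_algebraicClasses_tensor_self_of_CM`). Formal debt carried: Künneth for `H⁴((S ⊗ S)(ℂ);ℂ)`
with Hodge types on the real carriers (the debt already named by `SquareGlue`). Size L; research
risk nil (Ramón-Marí 2008 Thm 3.3, Buskin 2019 Cor., Huybrechts 2019 Cor. 0.4 (ii)). This stub is
also what makes the DIAGONAL self-pairs `(S₀, S₀)` of a CM-type `M` algebraic anchors. -/
theorem stub_cmSelfSimilitude_algebraic :
    Buskin2019_hodgeConjectureFor_square_of_CM → Huybrechts_K3_hodgeTypes_H2 →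
    ∀ (c : ℂ), c ≠ 0 → ∀ (J : Module.End ℂ (K3Index → ℂ)), RatEnd[J] →
      (∀ a b, k3Form (J a) (J b) = c * k3Form a b) →
      ∀ (x₀ : K3Index → ℂ) (t : ℂ), t.im ≠ 0 → J x₀ = t • x₀ →
      ∀ (μ : OrientationFamily), μ.HasPoincareDuality →
        ∀ (S : SchemeOver ℂ) (hS : IsK3Surface S)
          (η : complexBetti S (2 * 1) ≃ₗ[ℂ] (K3Index → ℂ)) (p : complexBetti S (2 * 2)),
          MarkedK3[S, η, p, x₀] → PeriodPt[x₀] →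
          ∃ γ ∈ algebraicClasses (MonoidalCategoryStruct.tensorObj S S) 2,
            ∀ y : complexBetti S (2 * 1), η.symm (J (η y)) = Corr[μ, S, S, hS, hS ; γ, y] := by
  sorry

/-- **Stub 5 — CM-norm periods of multiplier `q` are dense among projective period points, for
every prime `q`** (the card's "T-rank-20 anchors for EVERY multiplier" made quantitative; ideator
3's A2). Proof route: (a) EXISTENCE — `Λ_ℚ ≅ ⟨1,q⟩ ⊕ ⟨−1,−q⟩⁹ ⊕ U` over `ℚ` (both Witt classes are
`−16⟨1⟩`, using `4⟨q⟩ ≅ 4⟨1⟩` by quaternion norms; machine-checked by Hasse invariants for all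
squarefree `d ≤ 399`, triage jobs j007434/j007489), `J = (e ↦ f, f ↦ −q e)` on the ten `⟨a, aq⟩`
blocks `⊕ (u ↦ u, v ↦ q v)` on `U` is a rational `q`-similitude with rational inverse `−J/q ⊕ ν⁻¹`,
whose `√−q`-eigenspace is totally isotropic of Hermitian signature `(1,9)` — a 9-ball of periods,
all projective (`U ∋` positive vectors `⊥` them); simplest members: the singular K3 periods
(`x ∈ P_ℂ` isotropic, `P ⊂ Λ_ℚ` a positive 2-plane with `disc P ∈ q·ℚ×²`, e.g. `⟨2⟩ ⊕ ⟨2q⟩ ⊂ U²`).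
(b) DENSITY — positive rational 2-planes of prescribed discriminant class approximate every positive
real 2-plane: approximate `Re x` by a rational `u` (`u² > 0`), then inside the indefinite rank-21
form `u^⊥_ℚ` (universal, Hasse–Minkowski) the affine quadric `{v : v² = κ}` (`κ ∈ q u⁻² ℚ×²`) has a
rational point and is therefore unirational with dense rational points in its real locus; conjugate
`J` accordingly. (Equivalently: `SO(Λ_ℚ)(ℚ)` is dense in `SO(Λ_ℝ)⁰`, Borel 18.3, which acts
transitively on each component of the period domain; complex conjugation swaps the components and
preserves CM-norm periods since `J` is real.) Size M–L, provable now; research risk nil. -/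
theorem stub_cmNormPeriods_dense : ∀ q : ℕ, q.Prime → CMNormDense[((q : ℕ) : ℂ)] := by
  sorry

/-- **Stub 6 — THE ENGINE (open; where the crux's research risk lives): twin transport propagates
from the dense CM-norm anchor locus to every twin pair.** For every prime `q` and every rational
`q`-similitude `M` of `(Λ_ℂ, k3Form)` with two-sided rational inverse `N`: if the CM-norm periods of
multiplier `q` are dense among projective periods, and the twin similitude `η⁻¹ M η′` is algebraic
on every `M`-twin pair whose source is a CM-norm K3 (both hypotheses are THEOREMS of this line,
`stub_cmNormPeriods_dense` and `cmSourceTransport`), then it is algebraic on EVERY `M`-twin pair.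
Informally: the flat rational `(2,2)`-class `graph(M)` on the universal family of products over the
connected 19-dimensional twin Hecke correspondence `B_M` is algebraic on an analytically dense set
of fibres (and at the diagonal fibres `S₀ × S₀` when `M` is CM-type), hence — by ANY of: semiregular
deformation of one carrier at one anchor (Buchweitz–Flenner 2003 / Pridham / Perry arXiv:2604.00511
Thm 1.1, whose global clause gives algebraicity at every point of the base), a non-zero reduced
DT4 virtual cycle (Bae–Kool–Park arXiv:2208.09474 Thm 1.15 ⟹ VHC, `ρ_γ ≡ 20` on the twin locus),
hyperholomorphic twistor transport (route crux 14522), or a degree bound on the anchor cycles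
(closedness of the algebraic locus ⊇ dense set) — on all fibres. Why it might fail: a Voisin-type
vanishing "on a very general twin pair every coherent sheaf / perfect complex has `ch₂` with zero
`graph(M)`-component" (kill criterion (ii) of the route); no such statement is known. NOT a
restatement of the crux: its hypotheses hand the prover explicit algebraic anchors on a dense
locus; modulo the other five stubs it is equivalent to the crux at `q`, as every engine stub of an
anchor + engine line must be (Disproof v2 `primes_suffice`, triage common finding). Size XL / open. -/
theorem stub_twinPropagation :
    ∀ q : ℕ, q.Prime → ∀ (M N : Module.End ℂ (K3Index → ℂ)), RatEnd[M] → RatEnd[N] →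
      M * N = 1 → N * M = 1 → (∀ a b, k3Form (M a) (M b) = ((q : ℕ) : ℂ) * k3Form a b) →
      CMNormDense[((q : ℕ) : ℂ)] → CMSourceTransportFor[M, ((q : ℕ) : ℂ)] →
      TwinTransportFor[M] := by
  sorry

/-! ### Glue proved here: the anchor theorem in twin form (Buskin ∘ CM self-similitude) -/

/-- **Twin transport on CM-norm-source pairs** (the card's lever, assembled): granted Buskin's
theorem, the composition of correspondences, the Hodge types of `H²(K3)`, the CM-square corollary
and the anchor theorem `stub_cmSelfSimilitude_algebraic`, the twin similitude `ψ = η⁻¹ M η′` of a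
rational `c`-similitude `M` (`c ≠ 0`) is algebraic on every `M`-twin pair whose source period `x′`
is a CM-norm period of multiplier `c`: with `(J, K, t′)` the CM data at `x′`,
`e′ = η′⁻¹ J η′` is algebraic on `S′ × S′` (anchor theorem), `R = M K` is a rational ISOMETRY
carrying `x′` into the period line of `x` (`K x′ = t′⁻¹ x′`), so `η⁻¹ R η′ = ψ ∘ e′⁻¹` is algebraic
by Buskin in twin form (`twinTransport_of_simAlgAt` at multiplier `1`), and
`ψ = (η⁻¹ R η′) ∘ e′` is algebraic by composition. [folklore assembly of Buskin2019 Thm 1.1 + Cor.] -/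
theorem cmSourceTransport (hB : HodgeIsometryAlgebraic) (hC : CompCorr)
    (hHT : Huybrechts_K3_hodgeTypes_H2) (hCM : Buskin2019_hodgeConjectureFor_square_of_CM)
    (hA : Buskin2019_hodgeConjectureFor_square_of_CM → Huybrechts_K3_hodgeTypes_H2 →
      ∀ (c : ℂ), c ≠ 0 → ∀ (J : Module.End ℂ (K3Index → ℂ)), RatEnd[J] →
        (∀ a b, k3Form (J a) (J b) = c * k3Form a b) →
        ∀ (x₀ : K3Index → ℂ) (t : ℂ), t.im ≠ 0 → J x₀ = t • x₀ →
        ∀ (μ : OrientationFamily), μ.HasPoincareDuality →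
          ∀ (S : SchemeOver ℂ) (hS : IsK3Surface S)
            (η : complexBetti S (2 * 1) ≃ₗ[ℂ] (K3Index → ℂ)) (p : complexBetti S (2 * 2)),
            MarkedK3[S, η, p, x₀] → PeriodPt[x₀] →
            ∃ γ ∈ algebraicClasses (MonoidalCategoryStruct.tensorObj S S) 2,
              ∀ y : complexBetti S (2 * 1), η.symm (J (η y)) = Corr[μ, S, S, hS, hS ; γ, y])
    (c : ℂ) (hc : c ≠ 0) (M : Module.End ℂ (K3Index → ℂ)) (hMrat : RatEnd[M])
    (hMc : ∀ a b, k3Form (M a) (M b) = c * k3Form a b) : CMSourceTransportFor[M, c] := by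
  intro μ hμ S S' hS hS' η p x η' p' x' hm hx hm' hx' hper hcm
  obtain ⟨J, K, hJrat, hKrat, hJK, hKJ, hJc, t', ht'im, hJx'⟩ := hcm
  -- (1) the CM self-similitude `e' = η'⁻¹ J η'` of the source is algebraic on `S' × S'`
  obtain ⟨γ₁, hγ₁, hγ₁eq⟩ :=
    hA hCM hHT c hc J hJrat hJc x' t' ht'im hJx' μ hμ S' hS' η' p' hm' hx'
  -- (2) `R = M K` is a rational isometry carrying `x'` into the period line of `x`
  have ht'0 : t' ≠ 0 := by
    rintro rfl
    exact ht'im Complex.zero_im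
  have hKc : ∀ a b, k3Form (K a) (K b) = c⁻¹ * k3Form a b := fun a b => by
    have h := hJc (K a) (K b)
    rw [← Module.End.mul_apply J K a, ← Module.End.mul_apply J K b, hJK,
      Module.End.one_apply, Module.End.one_apply] at h
    rw [h, ← mul_assoc, inv_mul_cancel₀ hc, one_mul]
  have hRrat : RatEnd[M * K] := ratEnd_mul M K hMrat hKrat
  have hR1 : ∀ a b, k3Form ((M * K) a) ((M * K) b) = ((1 : ℚ) : ℂ) * k3Form a b := fun a b => by
    rw [Module.End.mul_apply, Module.End.mul_apply, hMc, hKc, ← mul_assoc, mul_inv_cancel₀ hc,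
      Rat.cast_one]
  have hKx' : K x' = t'⁻¹ • x' := by
    have h : (K * J) x' = K (t' • x') := by rw [Module.End.mul_apply, hJx']
    rw [hKJ, Module.End.one_apply, map_smul] at h
    conv_rhs => rw [h]
    rw [smul_smul, inv_mul_cancel₀ ht'0, one_smul]
  have hperR : ∃ s : ℂ, (M * K) x' = s • x := by
    obtain ⟨t, ht⟩ := hper
    exact ⟨t'⁻¹ * t, by rw [Module.End.mul_apply, hKx', map_smul, ht, smul_smul]⟩
  -- Buskin in twin form at multiplier `1` for `R`
  have hX : ∀ (μ : OrientationFamily), μ.HasPoincareDuality →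
      ∀ (S S' : SchemeOver ℂ)
        (hS : (IsSmoothProjective 2 S ∧ Subsingleton (structureSheafCohomology S.left 1) ∧
          ∃ (A : HodgeModel 2 S) (η : MForm 𝓘(ℝ, A.model) A.carrier ℂ 2),
            IsHolomorphicInCharts η ∧ ∀ x, η x ≠ 0))
        (hS' : (IsSmoothProjective 2 S' ∧ Subsingleton (structureSheafCohomology S'.left 1) ∧
          ∃ (A : HodgeModel 2 S') (η : MForm 𝓘(ℝ, A.model) A.carrier ℂ 2),
            IsHolomorphicInCharts η ∧ ∀ x, η x ≠ 0))
        (p : complexBetti S (2 * 2)) (p' : complexBetti S' (2 * 2)),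
        (IsIntegralClass p ∧ ∀ q : complexBetti S (2 * 2), IsIntegralClass q → ∃ n : ℤ, q = n • p) →
        (IsIntegralClass p' ∧
          ∀ q : complexBetti S' (2 * 2), IsIntegralClass q → ∃ n : ℤ, q = n • p') →
        ∀ (ψ : complexBetti S' (2 * 1) →ₗ[ℂ] complexBetti S (2 * 1)),
          (∀ x, IsRationalClass x → IsRationalClass (ψ x)) →
          (∀ (i j : ℕ) x, IsOfHodgeType 2 S' (2 * 1) i j x → IsOfHodgeType 2 S (2 * 1) i j (ψ x)) →
          (∀ (x y : complexBetti S' (2 * 1)) (a : ℂ),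
            cupProduct (rfl : 2 * 1 + 2 * 1 = 2 * 2) x y = a • p' →
              cupProduct (rfl : 2 * 1 + 2 * 1 = 2 * 2) (ψ x) (ψ y) = (((1 : ℚ) : ℂ) * a) • p) →
          ∃ γ ∈ algebraicClasses (MonoidalCategoryStruct.tensorObj S S') 2,
            ∀ x : complexBetti S' (2 * 1),
              ψ x = complexGysin μ (IsSmoothProjective.tensor_holds hS.1 hS'.1) hS.1
                (SemiCartesianMonoidalCategory.fst S S')
                (rfl : 2 * 1 + 2 * 2 + 2 * 2 = 2 * 1 + 2 * (2 + 2))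
                (cupProduct (rfl : 2 * 1 + 2 * 2 = 2 * 1 + 2 * 2)
                  (complexBetti.map (SemiCartesianMonoidalCategory.snd S S') (2 * 1) x) γ) := by
    intro μ hμ S S' hS hS' p p' hp hp' ψ hψr hψt hψs
    exact hB μ hμ S S' hS hS' p p' hp hp' ψ hψr hψt fun x y a hxy => by
      rw [hψs x y a hxy, Rat.cast_one, one_mul]
  have hBtw := twinTransport_of_simAlgAt (1 : ℚ) one_ne_zero hHT hX (M * K) hRrat hR1
  obtain ⟨γ₂, hγ₂, hγ₂eq⟩ := hBtw μ hμ S S' hS hS' η p x η' p' x' hm hx hm' hx' hperR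
  -- (3) compose `[γ₂]_* ∘ [γ₁]_*`
  obtain ⟨γ₃, hγ₃, hcomp⟩ :=
    hC μ hμ S S' S' (IsK3Surface.isSmoothProjective hS) (IsK3Surface.isSmoothProjective hS')
      (IsK3Surface.isSmoothProjective hS') γ₂ hγ₂ γ₁ hγ₁
  refine ⟨γ₃, hγ₃, fun y => ?_⟩
  have key : M (η' y) = (M * K) (η' (η'.symm (J (η' y)))) := by
    rw [LinearEquiv.apply_symm_apply, Module.End.mul_apply, ← Module.End.mul_apply K J (η' y),
      hKJ, Module.End.one_apply]
  rw [key, hγ₂eq (η'.symm (J (η' y))), hγ₁eq y]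
  exact (hcomp y).symm

/-! ### The composition: the six stubs imply the crux, by name -/

/-- `LineImplication` — THE SHAPE OF THE LINE as one proposition:
stub 1 → stub 2 → stub 3 → stub 4 → stub 5 → stub 6 → `HodgeSimilitudeAlgebraic`, the statements
of the six stubs spelled out verbatim (so that `lineImplication` below is a sorry-free,
kernel-checked certificate that the registered stub STATEMENTS compose into the crux, and
`HodgeSimilitudeAlgebraic_of` is literally `lineImplication stub_buskin … stub_twinPropagation`). -/
abbrev LineImplication : Prop :=
    HodgeIsometryAlgebraic →
    CompCorr →
    (Buskin2019_hodgeConjectureFor_square_of_CM ∧ Huybrechts_K3_periodSurjective_projective ∧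
      Huybrechts_K3_marking_exists ∧ Huybrechts_K3_hodgeTypes_H2) →
    (Buskin2019_hodgeConjectureFor_square_of_CM → Huybrechts_K3_hodgeTypes_H2 →
      ∀ (c : ℂ), c ≠ 0 → ∀ (J : Module.End ℂ (K3Index → ℂ)), RatEnd[J] →
        (∀ a b, k3Form (J a) (J b) = c * k3Form a b) →
        ∀ (x₀ : K3Index → ℂ) (t : ℂ), t.im ≠ 0 → J x₀ = t • x₀ →
        ∀ (μ : OrientationFamily), μ.HasPoincareDuality →
          ∀ (S : SchemeOver ℂ) (hS : IsK3Surface S)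
            (η : complexBetti S (2 * 1) ≃ₗ[ℂ] (K3Index → ℂ)) (p : complexBetti S (2 * 2)),
            MarkedK3[S, η, p, x₀] → PeriodPt[x₀] →
            ∃ γ ∈ algebraicClasses (MonoidalCategoryStruct.tensorObj S S) 2,
              ∀ y : complexBetti S (2 * 1), η.symm (J (η y)) = Corr[μ, S, S, hS, hS ; γ, y]) →
    (∀ q : ℕ, q.Prime → CMNormDense[((q : ℕ) : ℂ)]) →
    (∀ q : ℕ, q.Prime → ∀ (M N : Module.End ℂ (K3Index → ℂ)), RatEnd[M] → RatEnd[N] →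
      M * N = 1 → N * M = 1 → (∀ a b, k3Form (M a) (M b) = ((q : ℕ) : ℂ) * k3Form a b) →
      CMNormDense[((q : ℕ) : ℂ)] → CMSourceTransportFor[M, ((q : ℕ) : ℂ)] →
      TwinTransportFor[M]) →
    Summit.HodgeConjecture.HodgeConjecture.Theses.NikulinTwinTransport.HodgeSimilitudeAlgebraic

/-- **The six stub statements imply the crux** (sorry-free). Buskin (stub 1) + composition of
correspondences (stub 2) + the K3 package (stub 3) reduce the crux to twin transport for the
rational `q`-similitudes of `Λ` at every prime `q` (`hodgeSimilitudeAlgebraic_of_prime_twinTransport`,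
landed); twin transport for `M` is the ENGINE (stub 6) fed with the density of CM-norm anchors
(stub 5) and the transport on CM-norm-source pairs (`cmSourceTransport`: stubs 1, 2, 3, 4).
[folklore assembly] -/
theorem lineImplication : LineImplication := by
  intro hB hC hF hA hD hE
  obtain ⟨hCM, hP, hMk, hHT⟩ := hF
  refine hodgeSimilitudeAlgebraic_of_prime_twinTransport hB hC hP hMk hHT ?_
  intro q hq M N hMrat hNrat hMN hNM hMq
  have hq0 : ((q : ℕ) : ℂ) ≠ 0 := by exact_mod_cast hq.ne_zero
  exact hE q hq M N hMrat hNrat hMN hNM hMq (hD q hq)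
    (cmSourceTransport hB hC hHT hCM hA ((q : ℕ) : ℂ) hq0 M hMrat hMq)

/-- **`HodgeSimilitudeAlgebraic_of` — the crux BY NAME from the six registered stubs** (the only
`sorry`s of the file live inside `stub_*`; this composition and `lineImplication` are sorry-free). -/
theorem HodgeSimilitudeAlgebraic_of :
    Summit.HodgeConjecture.HodgeConjecture.Theses.NikulinTwinTransport.HodgeSimilitudeAlgebraic :=
  lineImplication stub_buskin stub_compCorr stub_k3Facts stub_cmSelfSimilitude_algebraic
    stub_cmNormPeriods_dense stub_twinPropagation

end Summit.HodgeConjecture.HodgeConjecture.Cruxes.HodgeSimilitudeAlgebraic.CmNormAnchors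

end
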